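import Summits.AtomisticToContinuum.FouriersLaw.Theorems.OddSectorIrreversibilitySubBallisticWindowSaturationEnvelope
import Summits.AtomisticToContinuum.FouriersLaw.Theorems.OddSectorIrreversibilityCorrectorTheoryDetFlow

/-!
# `SubBallisticWindow` (stmt-AtomisticToContinuum-14070): the flip-asymmetry (odd-sector) form of the windowed transport

Support file for crux `Summit.AtomisticToContinuum.FouriersLaw.Theses.OddSectorIrreversibility.SubBallisticWindow`
(E2 of route OddSectorIrreversibility). Notation as in `…SubBallisticWindowPartial`: closed pinned anharmonic chain
`pinnedChain ω₂ lam β γ` (`ω₂ > 0`, `lam, β ≥ 0`, any `γ`), Hamiltonian flow `Φ_t = detFlow`, momentum flip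
`Θ(q,p) = (q,-p)`, `μ_T = e^{-H/T} dq dp` (`gibbsWeight`) of mass `Z`, block `B = [k₁,k₂)` of length `ℓ = k₂ - k₁`,
`V_B(τ) = ∫ (∫_{(0,τ]} J_B(Φ_s x) ds)² dμ_T(x)` (`window`), and the right-plateau ramp energy
`W_B = ∑_k w_k h_k`, `w_k = min(k,k₂) ∸ k₁` for `k < N` (`Negative.ClosedFlow.weightedEnergy`), which satisfies
`{H, W_B} = J_B` exactly (`SaturationEnvelope.poisson_rightWeight`) and is `Θ`-even.

An EXACT IDENTITY (Liouville invariance of `μ_T` under `Φ_t` and `Θ`, and reversibility `Φ_t ∘ Θ ∘ Φ_t = Θ` of the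
Hamiltonian flow, `Corrector.detFlow_reversal`):

* `integral_sq_setIntegral_comp_detFlow_eq_flip` — for any `Θ`-even `G ∈ C²` with `{H,G} = J` and `t ≥ 0`,
  `∫ (∫_{(0,2t]} J(Φ_s x) ds)² dμ_T = ∫ (G(Φ_t x) - G(Φ_t (Θ x)))² dμ_T`;
* `window_sq_eq_flip` — the block case `G = W_B`, `J = J_B`:
  `V_B(2t) = ∫ (W_B(Φ_t x) - W_B(Φ_t(Θx)))² dμ_T`, i.e. `V_B(2t) = 4 ‖(W_B ∘ Φ_t)^{Θ-odd}‖²_{L²(μ_T)}`: the windowed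
  transport variance over `[0,2t]` is the mean-square sensitivity of the ramp energy transported for time `t` to
  flipping the initial momenta (the `Θ`-odd mass leaked into `W_B∘Φ_t`, which is `Θ`-even at `t = 0`);
* `subBallisticWindow_iff_flipAsymmetry` — hence the crux E2 is EQUIVALENT to the `N`-uniform bound
  `∫ (W_B(Φ_t x) - W_B(Φ_t(Θx)))² dμ_T ≤ C (1+t) ℓ Z` (all `N`, blocks with `k₂ + 1 ≤ N`, `t ≥ 0`): "the closed chain
  forgets the sign of its initial momenta, as seen by ramp energies, at most diffusively".

This is a reformulation in the route's odd-sector language, not progress on the `N`-uniform content of E2 (which is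
open in print, BLR2000 §6.3); Cauchy–Schwarz on `d/dt ‖(W_B∘Φ_t)^{odd}‖² = 2⟨(W_B∘Φ_t)^{odd}, J_B∘Φ_t⟩` returns only the
ballistic envelope. Nothing here closes the item. Lead c4 of line `Sketch`, 2026-08-17.
-/

noncomputable section

namespace Summit.AtomisticToContinuum.FouriersLaw.Theorems.SubBallisticWindow.FlipAsymmetry

open MeasureTheory Filter Topology Set
open scoped NNReal ENNReal ContDiff
open Literature.MathematicalPhysics.KineticTheory.HeatConduction
open Summit.AtomisticToContinuum.FouriersLaw.Theorems.SubBallisticWindow.Negative.ClosedFlow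
open Summit.AtomisticToContinuum.FouriersLaw.Theorems.ClosedConeSensitivity.Negative.ZeroFrictionDictionary
open Summit.AtomisticToContinuum.FouriersLaw.Theorems.OddSectorWitness
open Summit.AtomisticToContinuum.FouriersLaw.Theorems.OddSectorIrreversibility.Corrector
open Summit.AtomisticToContinuum.FouriersLaw.Theses.OddSectorIrreversibility

/-- Weighted site energies are even in the momenta: `W_w(q,-p) = W_w(q,p)`. [folklore] -/
theorem weightedEnergy_neg_momentum (P : OscillatorChain) (w : ℕ → ℝ) (N : ℕ) (x : PhaseSpace N) :
    weightedEnergy P w N (x.1, -x.2) = weightedEnergy P w N x := by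
  simp [weightedEnergy]

variable {ω₂ lam β : ℝ} (hω : 0 < ω₂) (hl : 0 ≤ lam) (hβ : 0 ≤ β)
include hω hl hβ

/-- **Flip-asymmetry identity** (abstract form). For the closed pinned chain, a continuous observable `J` with an
EXACT `Θ`-even corrector `G ∈ C²` (`{H, G} = J`, `G(q,-p) = G(q,p)`) and `t ≥ 0`:
`∫ (∫_{(0,2t]} J(Φ_s x) ds)² dμ_T(x) = ∫ (G(Φ_t x) - G(Φ_t(q,-p)))² dμ_T(x)`.
Proof: the window is the coboundary `G∘Φ_{2t} - G`; substitute `x ↦ Θ(Φ_t x)` (a `μ_T`-preserving map) and use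
`Φ_t(Θ(Φ_t x)) = Θ x` (reversibility) and `Φ_t ∘ Φ_t = Φ_{2t}`. [folklore] -/
theorem integral_sq_setIntegral_comp_detFlow_eq_flip (γ : ℝ) (N : ℕ) (T : ℝ) {t : ℝ} (ht : 0 ≤ t)
    {J : PhaseSpace N → ℝ} (hJ : Continuous J) {G : PhaseSpace N → ℝ} (hG : ContDiff ℝ 2 G)
    (hexact : ∀ x, poisson ((pinnedChain ω₂ lam β γ).hamiltonian N) G x = J x)
    (heven : ∀ x : PhaseSpace N, G (x.1, -x.2) = G x) :
    ∫ x, (∫ s in Ioc (0 : ℝ) (2 * t), J (detFlow ω₂ lam β N s x)) ^ 2 ∂(gibbsWeight ω₂ lam β γ N T) =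
      ∫ x, (G (detFlow ω₂ lam β N t x) - G (detFlow ω₂ lam β N t (x.1, -x.2))) ^ 2
        ∂(gibbsWeight ω₂ lam β γ N T) := by
  have h2t : 0 ≤ 2 * t := by positivity
  -- (1) exact corrector: the window is a pure coboundary
  have hcob : ∀ x, ∫ s in Ioc (0 : ℝ) (2 * t), J (detFlow ω₂ lam β N s x) =
      G (detFlow ω₂ lam β N (2 * t) x) - G x := by
    intro x
    rw [CoboundaryCeiling.setIntegral_comp_detFlow_eq_coboundary_add hω hl hβ γ N h2t hJ hG x]
    have h0 : (fun s => J (detFlow ω₂ lam β N s x) -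
        poisson ((pinnedChain ω₂ lam β γ).hamiltonian N) G (detFlow ω₂ lam β N s x)) = fun _ => 0 := by
      funext s
      rw [hexact]
      ring
    rw [h0, integral_zero, add_zero]
  -- (2) reversibility: the pointwise identity at `y = Θ (Φ_t x)`
  have hrev : ∀ x : PhaseSpace N, detFlow ω₂ lam β N t ((detFlow ω₂ lam β N t x).1, -(detFlow ω₂ lam β N t x).2) =
      (x.1, -x.2) := fun x => detFlow_reversal hω hl hβ N x ht
  have hadd : ∀ x : PhaseSpace N, detFlow ω₂ lam β N t (detFlow ω₂ lam β N t x) =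
      detFlow ω₂ lam β N (2 * t) x := fun x => by
    rw [two_mul, detFlow_add hω hl hβ N x ht ht]
  set F : PhaseSpace N → ℝ := fun y =>
    (G (detFlow ω₂ lam β N t y) - G (detFlow ω₂ lam β N t (y.1, -y.2))) ^ 2 with hF
  have hpt : ∀ x : PhaseSpace N, F ((detFlow ω₂ lam β N t x).1, -(detFlow ω₂ lam β N t x).2) =
      (G (detFlow ω₂ lam β N (2 * t) x) - G x) ^ 2 := by
    intro x
    simp only [hF, neg_neg, Prod.mk.eta]
    rw [hrev x, heven x, hadd x]
    ring
  -- (3) change of variables under the `μ_T`-preserving maps `Θ` and `Φ_t`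
  have hΘc : Continuous fun z : PhaseSpace N => ((z.1, -z.2) : PhaseSpace N) :=
    continuous_fst.prodMk continuous_snd.neg
  have hΦc : Continuous (detFlow ω₂ lam β N t) := continuous_detFlow hω hl hβ N t
  have hFc : Continuous F :=
    ((hG.continuous.comp hΦc).sub ((hG.continuous.comp hΦc).comp hΘc)).pow 2
  have hstep : ∫ y, F y ∂(gibbsWeight ω₂ lam β γ N T) =
      ∫ x, F ((detFlow ω₂ lam β N t x).1, -(detFlow ω₂ lam β N t x).2) ∂(gibbsWeight ω₂ lam β γ N T) := by
    rw [← integral_comp_momentumReversal_gibbsWeight γ N T F]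
    exact (CoboundaryCeiling.integral_comp_detFlow_gibbsWeight hω hl hβ γ N T ht
      (g := fun z : PhaseSpace N => F (z.1, -z.2)) (hFc.comp hΘc).aestronglyMeasurable).symm
  -- (4) assemble
  calc ∫ x, (∫ s in Ioc (0 : ℝ) (2 * t), J (detFlow ω₂ lam β N s x)) ^ 2 ∂(gibbsWeight ω₂ lam β γ N T)
      = ∫ x, (G (detFlow ω₂ lam β N (2 * t) x) - G x) ^ 2 ∂(gibbsWeight ω₂ lam β γ N T) := by
        simp only [hcob]
    _ = ∫ x, F ((detFlow ω₂ lam β N t x).1, -(detFlow ω₂ lam β N t x).2) ∂(gibbsWeight ω₂ lam β γ N T) := by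
        simp only [hpt]
    _ = ∫ y, F y ∂(gibbsWeight ω₂ lam β γ N T) := hstep.symm
    _ = _ := by simp only [hF]

/-- **Flip-asymmetry identity for the block transport.** For every block `[k₁,k₂)`, every `N` and `t ≥ 0`,
`V_B(2t) = ∫ (W_B(Φ_t x) - W_B(Φ_t(q,-p)))² dμ_T(x)` with `W_B` the right-plateau ramp energy
(`w_k = min(k,k₂) ∸ k₁` for `k < N`), whose Liouville derivative is exactly `J_B`. Equivalently
`V_B(2t) = 4 ‖(W_B∘Φ_t)^{Θ-odd}‖²_{L²(μ_T)}`. [folklore] -/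
theorem window_sq_eq_flip (γ : ℝ) (N : ℕ) (T : ℝ) (k₁ k₂ : ℕ) {t : ℝ} (ht : 0 ≤ t) :
    ∫ x, (window ω₂ lam β γ N k₁ k₂ (2 * t) x) ^ 2 ∂(gibbsWeight ω₂ lam β γ N T) =
      ∫ x, (weightedEnergy (pinnedChain ω₂ lam β γ) (fun k => if k < N then ((min k k₂ - k₁ : ℕ) : ℝ) else 0) N
              (detFlow ω₂ lam β N t x) -
            weightedEnergy (pinnedChain ω₂ lam β γ) (fun k => if k < N then ((min k k₂ - k₁ : ℕ) : ℝ) else 0) N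
              (detFlow ω₂ lam β N t (x.1, -x.2))) ^ 2 ∂(gibbsWeight ω₂ lam β γ N T) := by
  unfold window
  exact integral_sq_setIntegral_comp_detFlow_eq_flip hω hl hβ γ N T ht (continuous_blockCurrent N γ k₁ k₂)
    (contDiff_weightedEnergy _ (pinnedChain_contDiff_U ω₂ lam β γ) (pinnedChain_contDiff_V ω₂ lam β γ) _ N)
    (fun x => SaturationEnvelope.poisson_rightWeight γ k₁ k₂ x) (fun x => weightedEnergy_neg_momentum _ _ N x)

omit hω hl hβ

/-- **`SubBallisticWindow` ⟺ diffusive flip-asymmetry.** The crux E2 (an `N`-uniform ceiling on the windowed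
block transport of the closed Hamiltonian flow) is equivalent to: for all parameters `> 0`, `T > 0` there is `C`
such that for every `N`, block `[k₁,k₂)` with `k₂ + 1 ≤ N` and `t ≥ 0`,
`∫ (W_B(Φ_t x) - W_B(Φ_t(q,-p)))² e^{-H(x)/T} dx ≤ C (1+t) (k₂-k₁) Z` — the ramp energy transported for time `t`
depends on the SIGN of the initial momenta only diffusively, uniformly in the volume (`⇒` with constant
`2·max C 0` at window `2t`; `⇐` with `max C 0` at `t = τ/2`; both through `window_sq_eq_flip` and the Dirac
dictionary). [folklore] -/
theorem subBallisticWindow_iff_flipAsymmetry :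
    SubBallisticWindow ↔
    (∀ ω₂ lam β γ : ℝ, 0 < ω₂ → 0 < lam → 0 < β → 0 < γ → ∀ T : ℝ, 0 < T → ∃ C : ℝ,
      ∀ (N k₁ k₂ : ℕ), k₁ ≤ k₂ → k₂ + 1 ≤ N → ∀ t : ℝ, 0 ≤ t →
        ∫ x, (weightedEnergy (pinnedChain ω₂ lam β γ) (fun k => if k < N then ((min k k₂ - k₁ : ℕ) : ℝ) else 0) N
                (detFlow ω₂ lam β N t x) -
              weightedEnergy (pinnedChain ω₂ lam β γ) (fun k => if k < N then ((min k k₂ - k₁ : ℕ) : ℝ) else 0) N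
                (detFlow ω₂ lam β N t (x.1, -x.2))) ^ 2
            ∂(volume.withDensity fun x : PhaseSpace N =>
              ENNReal.ofReal (Real.exp (-((pinnedChain ω₂ lam β γ).hamiltonian N x) / T))) ≤
          C * (1 + t) * ((k₂ : ℝ) - k₁) *
            ∫ x : PhaseSpace N, Real.exp (-((pinnedChain ω₂ lam β γ).hamiltonian N x) / T)) := by
  -- the Dirac dictionary: the crux's left-hand side is `∫ window² dμ_T`
  have hdict : ∀ {ω₂ lam β : ℝ}, 0 < ω₂ → 0 ≤ lam → 0 ≤ β → ∀ (γ : ℝ) (N k₁ k₂ : ℕ) (T τ : ℝ),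
      ∫ x, (∫ s in Ioc (0 : ℝ) τ, (∫ y, (fun z : PhaseSpace N => ∑ i : Fin N,
        (if k₁ ≤ i.val ∧ i.val < k₂ then (pinnedChain ω₂ lam β γ).bondCurrent N i z else 0)) y
          ∂((pinnedChain ω₂ lam β 0).transitionKernel N T T s.toNNReal x))) ^ 2
          ∂(gibbsWeight ω₂ lam β γ N T) =
        ∫ x, (window ω₂ lam β γ N k₁ k₂ τ x) ^ 2 ∂(gibbsWeight ω₂ lam β γ N T) := by
    intro ω₂ lam β hω hl hβ γ N k₁ k₂ T τ
    refine integral_congr_ae (Eventually.of_forall fun x => ?_)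
    simp only
    unfold window
    congr 1
    refine setIntegral_congr_fun measurableSet_Ioc fun s hs => ?_
    rw [integral_transitionKernel_zero_friction hω hl hβ, Real.coe_toNNReal _ hs.1.le]
    rfl
  constructor
  · intro hE2 ω₂ lam β γ hω hl hβ hγ T hT
    obtain ⟨C, hC⟩ := hE2 ω₂ lam β γ hω hl hβ hγ T hT
    refine ⟨2 * max C 0, fun N k₁ k₂ hk hkN t ht => ?_⟩
    have h := hC N k₁ k₂ hk hkN (2 * t) (by positivity)
    simp only at h
    rw [show (volume.withDensity fun x : PhaseSpace N =>
        ENNReal.ofReal (Real.exp (-((pinnedChain ω₂ lam β γ).hamiltonian N x) / T))) =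
        gibbsWeight ω₂ lam β γ N T from rfl, hdict hω hl.le hβ.le γ N k₁ k₂ T (2 * t),
      window_sq_eq_flip hω hl.le hβ.le γ N T k₁ k₂ ht] at h
    rw [show (volume.withDensity fun x : PhaseSpace N =>
        ENNReal.ofReal (Real.exp (-((pinnedChain ω₂ lam β γ).hamiltonian N x) / T))) =
        gibbsWeight ω₂ lam β γ N T from rfl]
    have hZ0 : 0 ≤ ∫ x, Real.exp (-((pinnedChain ω₂ lam β γ).hamiltonian N x) / T) :=
      integral_nonneg fun _ => (Real.exp_pos _).le
    have hℓ0 : (0 : ℝ) ≤ (k₂ : ℝ) - k₁ := sub_nonneg.mpr (by exact_mod_cast hk)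
    have hw : 0 ≤ ((k₂ : ℝ) - k₁) * ∫ x, Real.exp (-((pinnedChain ω₂ lam β γ).hamiltonian N x) / T) := by
      positivity
    refine h.trans ?_
    calc C * (1 + 2 * t) * ((k₂ : ℝ) - k₁) * ∫ x, Real.exp (-((pinnedChain ω₂ lam β γ).hamiltonian N x) / T)
        = C * ((1 + 2 * t) * (((k₂ : ℝ) - k₁) *
            ∫ x, Real.exp (-((pinnedChain ω₂ lam β γ).hamiltonian N x) / T))) := by ring
      _ ≤ max C 0 * ((1 + 2 * t) * (((k₂ : ℝ) - k₁) *
            ∫ x, Real.exp (-((pinnedChain ω₂ lam β γ).hamiltonian N x) / T))) :=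
          mul_le_mul_of_nonneg_right (le_max_left _ _) (by positivity)
      _ ≤ max C 0 * ((2 * (1 + t)) * (((k₂ : ℝ) - k₁) *
            ∫ x, Real.exp (-((pinnedChain ω₂ lam β γ).hamiltonian N x) / T))) := by
          refine mul_le_mul_of_nonneg_left ?_ (le_max_right _ _)
          exact mul_le_mul_of_nonneg_right (by linarith) hw
      _ = _ := by ring
  · intro hF ω₂ lam β γ hω hl hβ hγ T hT
    obtain ⟨C, hC⟩ := hF ω₂ lam β γ hω hl hβ hγ T hT
    refine ⟨max C 0, fun N k₁ k₂ hk hkN τ hτ => ?_⟩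
    simp only
    rw [show (volume.withDensity fun x : PhaseSpace N =>
        ENNReal.ofReal (Real.exp (-((pinnedChain ω₂ lam β γ).hamiltonian N x) / T))) =
        gibbsWeight ω₂ lam β γ N T from rfl, hdict hω hl.le hβ.le γ N k₁ k₂ T τ]
    have hτ2 : 0 ≤ τ / 2 := by positivity
    have h := hC N k₁ k₂ hk hkN (τ / 2) hτ2
    rw [show (volume.withDensity fun x : PhaseSpace N =>
        ENNReal.ofReal (Real.exp (-((pinnedChain ω₂ lam β γ).hamiltonian N x) / T))) =
        gibbsWeight ω₂ lam β γ N T from rfl,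
      ← window_sq_eq_flip hω hl.le hβ.le γ N T k₁ k₂ hτ2] at h
    rw [show τ = 2 * (τ / 2) by ring]
    have hZ0 : 0 ≤ ∫ x, Real.exp (-((pinnedChain ω₂ lam β γ).hamiltonian N x) / T) :=
      integral_nonneg fun _ => (Real.exp_pos _).le
    have hℓ0 : (0 : ℝ) ≤ (k₂ : ℝ) - k₁ := sub_nonneg.mpr (by exact_mod_cast hk)
    have hw : 0 ≤ ((k₂ : ℝ) - k₁) * ∫ x, Real.exp (-((pinnedChain ω₂ lam β γ).hamiltonian N x) / T) := by
      positivity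
    refine h.trans ?_
    calc C * (1 + τ / 2) * ((k₂ : ℝ) - k₁) * ∫ x, Real.exp (-((pinnedChain ω₂ lam β γ).hamiltonian N x) / T)
        = C * ((1 + τ / 2) * (((k₂ : ℝ) - k₁) *
            ∫ x, Real.exp (-((pinnedChain ω₂ lam β γ).hamiltonian N x) / T))) := by ring
      _ ≤ max C 0 * ((1 + τ / 2) * (((k₂ : ℝ) - k₁) *
            ∫ x, Real.exp (-((pinnedChain ω₂ lam β γ).hamiltonian N x) / T))) :=
          mul_le_mul_of_nonneg_right (le_max_left _ _) (by positivity)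
      _ ≤ max C 0 * ((1 + 2 * (τ / 2)) * (((k₂ : ℝ) - k₁) *
            ∫ x, Real.exp (-((pinnedChain ω₂ lam β γ).hamiltonian N x) / T))) := by
          refine mul_le_mul_of_nonneg_left ?_ (le_max_right _ _)
          exact mul_le_mul_of_nonneg_right (by linarith) hw
      _ = _ := by ring

end Summit.AtomisticToContinuum.FouriersLaw.Theorems.SubBallisticWindow.FlipAsymmetry

end
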